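import Summits.ResolutionOfSingularities.ResolutionOfSingularities.Theorems.HilbertSamuelEliminationSigmaMaxModificationsCorridor3CPFrameMenuChainThroughFaces
import HarnessLib

/-!
# [OURS · L1 W4.2] D18 — CARRIER-FACING FORMS: the E-adapted propagation step WITH its tracking maps, and the whole-run packaging from an
# EMPTY initial boundary (the shape res-D-pv-060's `hbirth` produces)
# (cell res-hironaka, LADDER-RESOLUTION rung L; slot W4.2, crux chain w42 `SigmaMaxModificationsCorridor3` stmt-ResolutionOfSingularities-19249;
# `--supports stmt-ResolutionOfSingularities-19249 --as helper`; hand res-D-brk-3 (gen 7), file F3h — inputs BY NAME for res-D-pv-002's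
# `Sigma.ExactGroupCarrier` (C-MOVE / C-NEUTRAL) and for the 064-successor's board law (X2))

SCHEME-SIDE BOOKKEEPING (universe `0`), 0 `def`s, every declaration PROVED; OURS; NOT a statement of Hironaka's manuscript [Hironaka2017] nor of
[CossartJannsenSaito2020]/[CossartPiltant2019]. AI-written, weaker than expert review.

* **`IsCPFrame.exists_isCPFrame_blowup_adapted_tracked`** — p559398's `exists_isCPFrame_blowup_adapted` (exceptional divisor ↦ `(u'_{j₀})`,
  old member `j` ↦ `⊤` or `(u'_j)` with the SAME index) together with p557119's tracking data of the SAME frame: `β : B → B'` over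
  `ι : R → R'` with `φ' ∘ π♯ = β ∘ φ`, `β(r̄) = ι r`, `β(X̄) ∈ (ι u_{j₀})`, `u'_{j₀} = ι u_{j₀}`, `ι u_j = ι u_{j₀} · t` (`t = u'_j` or a unit) for
  `j ∈ T ∖ {j₀}`, `u'_j = ι u_j` off `T` — what a board law needs to compare `Δ(h'; u'; X')` with `Δ(h; u; X)`. (Same proof as p559398, the
  tracking not discarded.)
* **`exists_isCPFrame_adapted_of_reachesσE_through_of_faces_nil`** — the final packaging `…_through_of_faces` (p568780) from the EMPTY initial
  boundary `E₀ = []`: `h0` is then just «a complete minimal CP frame with `δ ≥ 1` at the origin» — verbatim the output of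
  `Moving.exists_isCPFrame_of_presentation_of_coeff_mem_pow` (res-D-pv-060, p563927).

References: CP 2019 Def. 2.6–2.7, Prop. 2.7 [CossartPiltant2019]; CJS LNM 2270 Rem. 6.29 (1) [CossartJannsenSaito2020]; GW (13.19) [GortzWedhorn2020];
Matsumura Thm. 7.4 (iii) [Matsumura1987].
-/

noncomputable section

set_option linter.dupNamespace false

open CategoryTheory AlgebraicGeometry TopologicalSpace IsLocalRing Polynomial
open Literature.AlgebraicGeometry.Resolution Literature.RingTheory.HilbertSamuel
open Summit.ResolutionOfSingularities.ResolutionOfSingularities.Theorems.CampaignW42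
open Summit.ResolutionOfSingularities.ResolutionOfSingularities.Theorems.SigmaMaxModificationsCorridor3.Sigma
open Summit.ResolutionOfSingularities.ResolutionOfSingularities.Theorems.SigmaMaxModificationsCorridor3.Helpers

namespace Summit.ResolutionOfSingularities.ResolutionOfSingularities.Theorems.SigmaMaxModificationsCorridor3.Moving

set_option maxHeartbeats 800000 in
-- the frame data of the tracked step are large terms
/-- [OURS · L1 W4.2] **D18 (i) E-ADAPTED AND TRACKED: the propagated CP frame reads the exceptional divisor and the transformed old members as
coordinate hyperplanes with the same indices, AND carries the comparison maps `β`, `ι` of the tracked step.** See the module docstring. [cite: CossartPiltant2019, Def. 2.6–2.7 and Prop. 2.7 (arXiv v1 p. 14)]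
[cite: GortzWedhorn2020, (13.19) p. 414] [cite: Matsumura1987, Thm. 7.4 (iii)] -/
theorem IsCPFrame.exists_isCPFrame_blowup_adapted_tracked {p : ℕ} {R₀ : ∀ S : Scheme.{0}, CentreSeq S → Prop}
    (hRf : OracleFunctional R₀) (hRa : OracleAdmissible R₀) {ν : ℕ → ℕ} {X₀ : Scheme.{0}} [IsLocallyNoetherian X₀] {x : X₀}
    (hX : IsMaximalOrigin p 3 ν X₀ x) {s : MarkedStage.{0}} (hs : Reaches R₀ 3 ν (MarkedStage.init X₀ x) s)
    (C : s.W.IdealSheafData) (P' : Option (Pending (blowup C))) (hln' : IsLocallyNoetherian (blowup C)) (x' : ↥(blowup C))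
    (hcs : IsCanonicalStep R₀ 3 ν s.L s.P C P') (hx' : (blowup.π C).base x' = s.pt) (hcl : IsClosed ({x'} : Set ↥(blowup C)))
    (hstr : x' ∈ Scheme.hsStratum (blowup C) 3 ν)
    {R : Type} [CommRing R] {u : Fin 3 → R} {h : R[X]}
    {φ : (s.W.presheaf.stalk s.pt : Type) →+* R[X] ⧸ Ideal.span {h}} (hF : IsCPFrame s R u h φ) (T : Finset (Fin 3))
    (hJ : (stalkIdeal C s.pt).map φ =
      ((Ideal.span (u '' ↑T)).map (Polynomial.C : R →+* R[X]) ⊔ Ideal.span {X}).map (Ideal.Quotient.mk (Ideal.span {h})))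
    (hcoT : ∀ i ∈ Finset.Icc 1 h.natDegree, h.coeff (h.natDegree - i) ∈ Ideal.span (u '' ↑T) ^ i) :
    ∃ (R' : Type) (_ : CommRing R') (_ : IsLocalRing R') (u' : Fin 3 → R') (h' : R'[X])
      (φ' : ((blowup C).presheaf.stalk x' : Type) →+* R'[X] ⧸ Ideal.span {h'})
      (β : R[X] ⧸ Ideal.span {h} →+* R'[X] ⧸ Ideal.span {h'}) (ι : R →+* R') (j₀ : Fin 3),
      IsCPFrame ⟨blowup C, hln', s.L.next (Scheme.hsStratum s.W 3 ν) C, P', x'⟩ R' u' h' φ' ∧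
        IsAdicComplete (maximalIdeal R') R' ∧ h'.natDegree = h.natDegree ∧
      (∀ i < h'.natDegree, h'.coeff i ∈ maximalIdeal R' ^ (h'.natDegree - i)) ∧
      (∀ a, φ' (((blowup.π C).stalkMap x').hom a) = β (φ ((s.W.presheaf.stalkCongr (Inseparable.of_eq hx')).hom a))) ∧
      (∀ r : R, β (Ideal.Quotient.mk _ (Polynomial.C r)) = Ideal.Quotient.mk _ (Polynomial.C (ι r))) ∧
      β (Ideal.Quotient.mk _ X) ∈ Ideal.span {Ideal.Quotient.mk _ (Polynomial.C (ι (u j₀)))} ∧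
      j₀ ∈ T ∧ u' j₀ = ι (u j₀) ∧
      (∀ j ∈ T, j ≠ j₀ → ∃ t : R', ι (u j) = ι (u j₀) * t ∧ (t = u' j ∨ IsUnit t)) ∧
      (∀ j, j ∉ T → u' j = ι (u j)) ∧
      (stalkIdeal (C.comap (blowup.π C)) x').map φ' = Ideal.span {Ideal.Quotient.mk _ (Polynomial.C (u' j₀))} ∧
      ∀ (K : s.W.IdealSheafData) (j : Fin 3),
        (stalkIdeal K s.pt).map φ = Ideal.span {Ideal.Quotient.mk _ (Polynomial.C (u j))} →
        stalkIdeal (strictTransformIdeal (blowup.π C) C K) x' = ⊤ ∨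
          (j ≠ j₀ ∧ (stalkIdeal (strictTransformIdeal (blowup.π C) C K) x').map φ' =
            Ideal.span {Ideal.Quotient.mk _ (Polynomial.C (u' j))}) := by
  classical
  obtain ⟨R', _, _, u', h', φ', β, ι, j₀, hF', hcpl, hdeg, hco, hcompat, hβC, hβX, hj₀T, hu'0, hT, hoff⟩ :=
    hF.exists_isCPFrame_blowup_tracked hRf hRa hX hs C P' hln' x' hcs hx' hcl hstr T hJ hcoT
  have hF'' := hF'
  obtain ⟨hreg', hloc', hdim', hu', hmon', hφl', hflat', hmap', -, -⟩ := hF''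
  haveI := hreg'
  haveI := hloc'
  haveI : IsLocallyNoetherian s.W := s.ln
  haveI : IsLocallyNoetherian (blowup C) := hln'
  haveI : IsDomain R' := isDomain_of_isRegularLocalRing R'
  have hz' : IsRsopPart u' := ⟨hreg', 0, Fin.elim0, by rw [hdim']; rfl, by rw [← hu']; congr 1; ext w; simp⟩
  set B' := R'[X] ⧸ Ideal.span {h'} with hB'
  set c₀ : B' := Ideal.Quotient.mk _ (Polynomial.C (u' j₀)) with hc₀
  -- the composite `φ' ∘ π♯ = β ∘ φ ∘ (stalk transport)`
  set cong := (s.W.presheaf.stalkCongr (Inseparable.of_eq hx')).hom.hom with hcong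
  have hcomp : φ'.comp ((blowup.π C).stalkMap x').hom = β.comp (φ.comp cong) :=
    RingHom.ext fun a => hcompat a
  have htransport : ∀ K : s.W.IdealSheafData,
      ((stalkIdeal K ((blowup.π C).base x')).map ((blowup.π C).stalkMap x').hom).map φ' = ((stalkIdeal K s.pt).map φ).map β := by
    intro K
    rw [Ideal.map_map, hcomp, stalkIdeal_eq_map_stalkCongr_hom_of_eq hx' K, Ideal.map_map, Ideal.map_map]
    rfl
  -- (E) the exceptional divisor
  have hc₀' : c₀ = Ideal.Quotient.mk _ (Polynomial.C (ι (u j₀))) := by rw [hc₀, hu'0]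
  have hexc : (stalkIdeal (C.comap (blowup.π C)) x').map φ' = Ideal.span {c₀} := by
    rw [stalkIdeal_comap_eq_map_stalkMap, htransport C, hJ]
    apply le_antisymm
    · rw [Ideal.map_le_iff_le_comap, Ideal.map_le_iff_le_comap, sup_le_iff, Ideal.map_le_iff_le_comap, Ideal.span_le, Ideal.span_le,
        Set.singleton_subset_iff]
      refine ⟨?_, ?_⟩
      · rintro _ ⟨t, ht, rfl⟩
        rw [SetLike.mem_coe, Ideal.mem_comap, Ideal.mem_comap, Ideal.mem_comap, hβC]
        by_cases ht0 : t = j₀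
        · subst ht0
          rw [← hc₀']
          exact Ideal.mem_span_singleton_self _
        · obtain ⟨tt, htt, -⟩ := hT t (Finset.mem_coe.mp ht) ht0
          rw [htt, map_mul, map_mul, ← hc₀']
          exact Ideal.mul_mem_right _ _ (Ideal.mem_span_singleton_self _)
      · rw [SetLike.mem_coe, Ideal.mem_comap, Ideal.mem_comap, hc₀']
        exact hβX
    · rw [Ideal.span_singleton_le_iff_mem, hc₀', ← hβC]
      exact Ideal.mem_map_of_mem _ (Ideal.mem_map_of_mem _ (Ideal.mem_sup_left
        (Ideal.mem_map_of_mem _ (Ideal.subset_span ⟨j₀, Finset.mem_coe.mpr hj₀T, rfl⟩))))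
  refine ⟨R', inferInstance, inferInstance, u', h', φ', β, ι, j₀, hF', hcpl, hdeg, hco, hcompat, hβC, hβX, hj₀T, hu'0, hT, hoff, hexc,
    fun K j hK => ?_⟩
  -- (M) an old member read as `(u_j)`
  letI algφ' : Algebra ((blowup C).presheaf.stalk x' : Type) B' := φ'.toAlgebra
  haveI : Module.Flat ((blowup C).presheaf.stalk x' : Type) B' := hflat'
  have hc₀nzd : c₀ ∈ nonZeroDivisors B' := mk_C_mem_nonZeroDivisors_of_ne_zero hmon' (hz'.ne_zero j₀)
  have hKβ : ((stalkIdeal K ((blowup.π C).base x')).map ((blowup.π C).stalkMap x').hom).map φ' =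
      Ideal.span {Ideal.Quotient.mk _ (Polynomial.C (ι (u j)))} := by
    rw [htransport K, hK, Ideal.map_span, Set.image_singleton, hβC]
  -- the stalk of the strict transform, extended to `B'`
  have hsat : (stalkIdeal (strictTransformIdeal (blowup.π C) C K) x').map φ' =
      ⨆ n : ℕ, (Ideal.span {Ideal.Quotient.mk _ (Polynomial.C (ι (u j)))}).colon ((Ideal.span {c₀} ^ n : Ideal B') : Set B') := by
    rw [stalkIdeal_strictTransformIdeal (blowup.π C) C K x', Ideal.map_iSup]
    refine iSup_congr fun n => ?_
    have hfg : ((stalkIdeal (C.comap (blowup.π C)) x') ^ n).FG := IsNoetherian.noetherian _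
    have h1 := Ideal.map_colon_of_flat (A := ((blowup C).presheaf.stalk x' : Type)) (B := B')
      ((stalkIdeal K ((blowup.π C).base x')).map ((blowup.π C).stalkMap x').hom) ((stalkIdeal (C.comap (blowup.π C)) x') ^ n) hfg
    rw [RingHom.algebraMap_toAlgebra] at h1
    rw [h1, Ideal.map_pow, hexc, hKβ]
  -- case analysis on the index `j`
  by_cases hjT : j ∈ T
  · by_cases hj0 : j = j₀
    · -- the member `V(u_{j₀})`: its strict transform misses the `u_{j₀}`-chart
      left
      subst hj0
      apply eq_top_of_map_eq_top_of_map_maximalIdeal φ' hmap'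
      rw [hsat, eq_top_iff]
      refine le_trans ?_ (le_iSup _ 1)
      intro b _
      rw [Submodule.mem_colon]
      intro w hw
      have hw' : w ∈ Ideal.span {c₀} := Ideal.pow_le_self one_ne_zero hw
      rw [smul_eq_mul, ← hc₀']
      exact Ideal.mul_mem_left _ _ hw'
    · obtain ⟨t, ht, htcase⟩ := hT j hjT hj0
      rcases htcase with rfl | htu
      · -- the transform reads `(u'_j)`
        right
        refine ⟨hj0, ?_⟩
        rw [hsat, ht, map_mul, map_mul, ← hc₀']
        exact iSup_colon_span_singleton_mul_pow_eq (fun b hb => mem_span_mk_C_of_mk_C_mul_mem hz' hmon' (i := j₀) (j := j) (Ne.symm hj0) hb)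
          hc₀nzd
      · -- `t` a unit: the transform misses `x'`
        left
        apply eq_top_of_map_eq_top_of_map_maximalIdeal φ' hmap'
        rw [hsat, eq_top_iff]
        refine le_trans ?_ (le_iSup _ 1)
        intro b _
        rw [Submodule.mem_colon]
        intro w hw
        have hw' : w ∈ Ideal.span {c₀} := Ideal.pow_le_self one_ne_zero hw
        have hunit : IsUnit (Ideal.Quotient.mk (Ideal.span {h'}) (Polynomial.C t)) := htu.map ((Ideal.Quotient.mk (Ideal.span {h'})).comp Polynomial.C)
        rw [smul_eq_mul, ht, map_mul, map_mul, Ideal.span_singleton_mul_right_unit hunit, ← hc₀']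
        exact Ideal.mul_mem_left _ _ hw'
  · -- a member transversal to the centre: reads `(u'_j)`
    right
    refine ⟨fun h0 => hjT (h0 ▸ hj₀T), ?_⟩
    rw [hsat, ← hoff j hjT]
    exact iSup_colon_span_singleton_pow_eq_of_forall_mem
      (fun b hb => mem_span_mk_C_of_mk_C_mul_mem hz' hmon' (i := j₀) (j := j) (fun h0 => hjT (by rw [← h0]; exact hj₀T)) hb)

/-- [OURS · L1 W4.2] **D18 `hread_menu` packaging from the EMPTY initial boundary.** See the module docstring.
[cite: CossartPiltant2019, Def. 2.6–2.7, Prop. 2.7 (arXiv v1 p. 14)] [cite: CossartJannsenSaito2020, Rem. 6.29 (1)] -/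
theorem exists_isCPFrame_adapted_of_reachesσE_through_of_faces_nil {p : ℕ} {R₀ : ∀ S : Scheme.{0}, CentreSeq S → Prop}
    (hRf : OracleFunctional R₀) (hRa : OracleAdmissible R₀) {ν : ℕ → ℕ} {X₀ : Scheme.{0}} [IsLocallyNoetherian X₀] {x : X₀}
    (hX : IsMaximalOrigin p 3 ν X₀ x)
    (hface : ∀ s : MarkedStageE.{0}, ReachesσE (Strategy.cjs R₀).withBoundary 3 ν (MarkedStageE.init X₀ x []) s →
      ∀ (C : s.W.IdealSheafData) (P' : Option (Pending (blowup C))), IsCanonicalStep R₀ 3 ν s.L s.P C P' →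
      s.pt ∈ (C.support : Set s.W) →
      ∃ K : Finset s.W.IdealSheafData, (∀ I ∈ K, I ∈ membersThrough s.E s.pt ∧ stalkIdeal I s.pt ≤ stalkIdeal C s.pt) ∧
        (∀ I ∈ K, ∀ I' ∈ K, stalkIdeal I s.pt = stalkIdeal I' s.pt → I = I') ∧
        ringKrullDim ((s.W.presheaf.stalk s.pt : Type) ⧸ stalkIdeal C s.pt) + K.card = 3)
    (h0 : ∃ (R : Type) (_ : CommRing R) (_ : IsLocalRing R) (u : Fin 3 → R) (h : R[X])
      (φ : ((MarkedStage.init X₀ x).W.presheaf.stalk (MarkedStage.init X₀ x).pt : Type) →+* R[X] ⧸ Ideal.span {h}),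
      IsCPFrame (MarkedStage.init X₀ x) R u h φ ∧ IsAdicComplete (maximalIdeal R) R ∧
      ∀ i < h.natDegree, h.coeff i ∈ maximalIdeal R ^ (h.natDegree - i))
    {s : MarkedStageE.{0}} (hs : ReachesσE (Strategy.cjs R₀).withBoundary 3 ν (MarkedStageE.init X₀ x []) s) :
    ∃ (R : Type) (_ : CommRing R) (_ : IsLocalRing R) (u : Fin 3 → R) (h : R[X])
      (φ : (s.W.presheaf.stalk s.pt : Type) →+* R[X] ⧸ Ideal.span {h}) (e : s.W.IdealSheafData → Fin 3),
      IsCPFrame s.toMarkedStage R u h φ ∧ IsAdicComplete (maximalIdeal R) R ∧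
      (∀ i < h.natDegree, h.coeff i ∈ maximalIdeal R ^ (h.natDegree - i)) ∧
      ∀ I ∈ membersThrough s.E s.pt, (stalkIdeal I s.pt).map φ = Ideal.span {Ideal.Quotient.mk _ (Polynomial.C (u (e I)))} := by
  obtain ⟨R, _, _, u, h, φ, hF, hcpl, hco⟩ := h0
  refine exists_isCPFrame_adapted_of_reachesσE_through_of_faces hRf hRa hX [] hface
    ⟨R, inferInstance, inferInstance, u, h, φ, fun _ => 0, hF, hcpl, hco, fun I hI => ?_⟩ hs
  -- the empty boundary has no member through the origin
  have h1 : I ∈ ([] : Boundary X₀) := (mem_membersThrough_iff.mp hI).1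
  exact absurd h1 List.not_mem_nil

end Summit.ResolutionOfSingularities.ResolutionOfSingularities.Theorems.SigmaMaxModificationsCorridor3.Moving

end
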